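import Summits.KontsevichZagierPeriods.KontsevichZagierPeriods.Theses.UnfoldedStokes
import Summits.KontsevichZagierPeriods.KontsevichZagierPeriods.Theorems.UnfoldedStokesCubeKernelStepStubSlabGluing
import Literature.NumberTheory.Transcendental.KZFibredRelations
import Literature.NumberTheory.Transcendental.KZLogCalculusProofs
import Literature.NumberTheory.Transcendental.KZProductIdeal

/-!
# Line `Sketch` (layers) — skeleton for crux `CubeKernelStep` (stmt-KontsevichZagierPeriods-17854)

Lead prover `prover-line-stmt-KontsevichZagierPeriods-17854-0`, 2026-08-17; line picked: `Sketch`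
(crux-ideate r1 k1, card `Cruxes/CubeKernelStep/Ideas/relative-injectivity-functional-layer.md`),
reshaped over TREE VOCABULARY ONLY (every stub signature is self-contained: no skeleton-local
definition occurs in it, so each stub can be stated verbatim in a `Theorems/` file).

The crux (route UnfoldedStokes, piece 3/3 of the BC2 split of `StokesGeneration`): for `d ≥ 1`,
IF every closed-cube representation of dimension `≤ d` with integrand continuous on the closed
cube and value `0` is a relation (`K(≤d)`), THEN so is every such representation of dimension
`d + 1`.

DÉVISSAGE over the parameter coordinate `s = z 0` of the `(d+1)`-cube (fibre = `[0,1]^d`):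

* `stub_meanRealisation` (K2, the SPORADIC core, GPC-strength, held by the lead; filed by the
  crux-strategist s1 as child 1 `MeanRealisation` of the split of this crux, SPLIT-FILING.md):
  under `K(≤d)`, a continuous `(d+1)`-cube representation of value `0` is congruent modulo
  `KZ.relations` to a continuous one that is FIBRE-NULL (`KZ.sliceValue t' s = 0` for every
  `s ∈ [0,1]`).
* `stub_fibreNullGerm` (K1 in GERM form, the FUNCTIONAL layer; child 2 `FibreNullGerm` of the
  split): under `K(≤d)`, a continuous fibre-null family is a relation on every small rational slab
  `{a < z 0 < b}` around every parameter `s₀ ∈ [0,1]`. Cycle 1: `stub-blocked` on the named fact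
  `Literature.NumberTheory.Transcendental.AyoubRel.ayoub_relativeKZ_revisited` (Tate sector only;
  Thm 1.11-type injectivity, semialgebraic→germ transposition, slab spreading all missing).
* slab gluing — LANDED (`Layers.stub_slabGluing`, p146658).

Composition `CubeKernelStep_of_stubs` (real): K2, then K1 at every `s₀`, a Lebesgue number of
the cover of `[0,1]` by the germ windows gives an equipartition all of whose slabs are
relations, then slab gluing; `[t] = ([t] − [t']) + [t']`. (The crux-strategist's `Split.lean`
glue `MeanRealisation → FibreNullGerm → CubeKernelStep` is this composition verbatim: once the
split is executed, `cubeKernelStep_of_layers` lands as `Theorems/UnfoldedStokesCubeKernelStepSplit.lean`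
`--workitem <glue item>`.)

RUNG stubs LANDED in cycle 1 (wave 1): `Layers.stub_ratBoxes` (p149158), `stub_separatedRankOne`
(p146588), `stub_derivativeSubLayer` (p149470), `stub_fibreNullPolynomial` (p146596).

RUNG stubs LANDED in cycle 1 (wave 2): `stub_primitiveCompression` (p152107; verbatim the
crux-strategist's rung of `Lines/three_sectors.lean` — the non-fibred mechanism of K2: fibred shear,
TRANSPOSITION, Newton–Leibniz along the parameter), `stub_separatedRankTwoAlgebraic` (p151541;
product sector, rank two, algebraic ratio), `stub_fibreNullFiniteRankIndep` (p151572; K1 in the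
finite-rank sector with linearly independent parameter functions).

RUNG stubs LANDED in cycle 1 (wave 3): `stub_derivativeMarginal` (p154339; verbatim the
crux-strategist's rung — a K2 instance: marginals with a continuous `ℚ`-semialgebraic derivative
are realised and removed inside dimension `d+1`), `stub_fibreNullFiniteRank` (p153365; the
crux-strategist's `FibreNullFiniteRank` — K1 in the whole finite-rank sector, by descent of real
linear dependencies among `ℚ`-semialgebraic functions to real-algebraic coefficients + the landed
independent case).

RUNG stubs LANDED in cycle 1 (wave 4): `stub_semialgebraicMarginal` (p154952; K2 ⟺
`MarginalSemialgebraic` modulo `K(≤d)`, with the crux-strategist's proved converse),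
`stub_fibreNullOddReflection` (p154894; unconditional: integrands odd under the reflection of one
coordinate are relations — via the tree's `KZ.of_sub_of_mem_relations_of_boxReflection`).

RUNG stub registered for cycle 2 (provable now from the landed rungs; not used by the composition):
* `stub_sqRepMemRelations` — the standing disprover's witness `sqRep = [□², 1/(1+x) − s/(2−sx) −
  s/(1+sx)]` (Negative/StepRule2.lean: NOT generated by rules (1),(3) + dim ≤ 1, nor by fibred
  moves + dim ≤ 1 + the ideal `I₁`) IS a relation of the full calculus, UNCONDITIONALLY (Disproof
  §E3 open handle): `sqFun(s,x) = sqFun(0,x) + s·w(sx)` EXACTLY with `w(u) = −1/(2−u) − 1/(1+u)`,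
  so `[sqRep] ≡ [□¹, 1/(1+u)] + [□¹, (1−u) w(u)]` (silent variable; LANDED
  `stub_primitiveCompression`, `k = 0`) `= [□¹, 1/(2−u) − 1/(1+u)]` (rule (1b)), which is ODD under
  `u ↦ 1−u`, hence a relation (LANDED `stub_fibreNullOddReflection`). The one non-fibred move is
  the transposition inside `stub_primitiveCompression`.

Sorries: exactly the three stubs. `CubeKernelStep_of_stubs` concludes the ROUTE DECL by name.
-/

noncomputable section

set_option linter.dupNamespace false

namespace Summit.KontsevichZagierPeriods.KontsevichZagierPeriods.Cruxes.CubeKernelStep.Layers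

open MeasureTheory Set Filter Metric
open scoped Topology BigOperators
open Literature.NumberTheory.Transcendental
open Literature.NumberTheory.Transcendental.KZ
open Summit.KontsevichZagierPeriods.KontsevichZagierPeriods.Theses.UnfoldedStokes (CubeKernelStep)

/-! ## Composition stubs -/

/-- STUB K2 (`open problem`, GPC-strength; held by the lead; = child 1 `MeanRealisation` of the
crux-strategist split): **mean realisation.** Under the lower layers `K(≤d)`, a continuous
closed `(d+1)`-cube representation of value `0` is congruent modulo `KZ.relations` to a continuous
closed-cube representation all of whose slice values over the parameter coordinate `z 0` vanish.
Implied by the summit (`t' := 0`). By the standing disprover's ★★/★★★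
(`Negative/NotFibred.lean`, `IdealSlices.lean`) every proof moves the parameter coordinate:
`[t] − [t']` has transcendental slice function and is not in `fibredRelations ⊔ closure lowDim`,
even modulo the lower-kernel ideal. First instances (`d = 1`): `ζ(2) = π²/6`
(Beukers–Kolk–Calabi), Legendre's relation, dilogarithm identities; realisable marginals known so
far: parameter derivatives (LANDED `stub_derivativeSubLayer`), marginals with a semialgebraic
derivative (rung `stub_derivativeMarginal` of line three_sectors, after `stub_primitiveCompression`),
transport defects `V_w − V_{(w∘Φ)|JΦ|}` of non-fibred rule-(2) maps. -/
theorem stub_meanRealisation :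
    ∀ d : ℕ, 1 ≤ d →
      (∀ (M : ℕ), M ≤ d → ∀ (a : IntegralRep M),
        a.domain = Set.pi Set.univ (fun _ : Fin M => Set.Icc (0:ℝ) 1) →
        ContinuousOn a.integrand a.domain → a.value = 0 → of a ∈ relations) →
      ∀ (t : IntegralRep (d + 1)),
        t.domain = Set.pi Set.univ (fun _ : Fin (d + 1) => Set.Icc (0:ℝ) 1) →
        ContinuousOn t.integrand t.domain → t.value = 0 →
        ∃ t' : IntegralRep (d + 1),
          t'.domain = Set.pi Set.univ (fun _ : Fin (d + 1) => Set.Icc (0:ℝ) 1) ∧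
          ContinuousOn t'.integrand t'.domain ∧
          (∀ s ∈ Set.Icc (0:ℝ) 1, sliceValue t' s = 0) ∧
          of t - of t' ∈ relations := by
  sorry

/-- STUB K1 (`open`, functional; germ form; = child 2 `FibreNullGerm` of the crux-strategist
split; cycle 1: `stub-blocked` on `Literature.NumberTheory.Transcendental.AyoubRel.ayoub_relativeKZ_revisited`):
**fibre-null germs are relations.** Under `K(≤d)`, a continuous closed `(d+1)`-cube
representation all of whose slice values over `z 0` vanish is a relation on every small enough
rational slab around every parameter value `s₀ ∈ [0,1]`. Implied by the summit (each slab
restriction has value `0` by Fubini). Model: Ayoub, Tohoku Math. J. 71 (2019) Thm 1.7 / 1.11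
(relative injectivity), the absolute kernel elements of fibre dimension `≤ d` being paid for by
`K(≤d)` through the two-sided ideal `KZ.relations`. Landed sectors: polynomial families
(`stub_fibreNullPolynomial`); registered: finite rank with independent parameter functions
(`stub_fibreNullFiniteRankIndep`); next: rational fibres at `d = 1` (leray-devissage
`FibrewiseZeroRationalTwo`: parametric partial fractions, function-field Baker, fibred dlog
homotopies, `baker_holds`). -/
theorem stub_fibreNullGerm :
    ∀ d : ℕ, 1 ≤ d →
      (∀ (M : ℕ), M ≤ d → ∀ (a : IntegralRep M),
        a.domain = Set.pi Set.univ (fun _ : Fin M => Set.Icc (0:ℝ) 1) →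
        ContinuousOn a.integrand a.domain → a.value = 0 → of a ∈ relations) →
      ∀ (t : IntegralRep (d + 1)),
        t.domain = Set.pi Set.univ (fun _ : Fin (d + 1) => Set.Icc (0:ℝ) 1) →
        ContinuousOn t.integrand t.domain →
        (∀ s ∈ Set.Icc (0:ℝ) 1, sliceValue t s = 0) →
        ∀ s₀ ∈ Set.Icc (0:ℝ) 1, ∃ ε : ℝ, 0 < ε ∧
          ∀ a b : ℚ, s₀ - ε ≤ (a : ℝ) → (a : ℝ) < b → (b : ℝ) ≤ s₀ + ε →
            of (t.slabRestrict a b) ∈ relations := by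
  sorry

/-! ## Rung stub, cycle 2 (special case; not used by the composition) -/

/-- RUNG (provable now, M; unconditional; Disproof §E3): **the disprover's square witness is a
relation of the full calculus.** Every representation on the closed square whose integrand agrees
there with `sqFun (s,x) = 1/(1+x) − s/(2−sx) − s/(1+sx)` (`s = z 0`, `x = z 1`; value `0`,
marginal `log((2−s)/(1+s))`) lies in `KZ.relations`: `sqFun(s,x) = 1/(1+x) + s·w(sx)` with
`w(u) = −1/(2−u) − 1/(1+u)`; the first summand is the lift of `[□¹, 1/(1+u)]`, the second is
compressed by `stub_primitiveCompression` (`k = 0`) to `[□¹, (1−u)·w(u)] = [□¹, −(1−u)/(2−u) −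
(1−u)/(1+u)]`; the sum `[□¹, 1/(1+u) − (1−u)/(2−u) − (1−u)/(1+u)] = [□¹, 1/(2−u) − 1/(1+u)]` is odd
under `u ↦ 1 − u` (`stub_fibreNullOddReflection`). In particular
`of CubeKernelStepNegative.sqRep ∈ relations` (corollary, with `sqRep_domain`). -/
theorem stub_sqRepMemRelations :
    ∀ t : IntegralRep 2, t.domain = Set.pi Set.univ (fun _ : Fin 2 => Set.Icc (0:ℝ) 1) →
      Set.EqOn t.integrand
        (fun z => 1 / (1 + z 1) - z 0 / (2 - z 0 * z 1) - z 0 / (1 + z 0 * z 1)) t.domain →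
      of t ∈ relations := by
  sorry

/-! ## The composition (real proof) -/

/-- **Lebesgue-number step.** If around every parameter `s₀ ∈ [0,1]` all small rational slabs of a
family are relations, then for some `N ≥ 1` every slab of the rational equipartition of mesh `1/N`
is a relation. -/
theorem exists_equipartition_of_germs {d : ℕ} (t : IntegralRep (d + 1))
    (hgerm : ∀ s₀ ∈ Set.Icc (0:ℝ) 1, ∃ ε : ℝ, 0 < ε ∧
      ∀ a b : ℚ, s₀ - ε ≤ (a : ℝ) → (a : ℝ) < b → (b : ℝ) ≤ s₀ + ε →
        of (t.slabRestrict a b) ∈ relations) :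
    ∃ N : ℕ, 0 < N ∧
      ∀ k : ℕ, k < N → of (t.slabRestrict ((k : ℚ) / N) (((k : ℚ) + 1) / N)) ∈ relations := by
  classical
  -- the germ windows, indexed by the points of `[0,1]`
  choose! ε hε hslab using hgerm
  obtain ⟨δ, hδ, hcov⟩ := lebesgue_number_lemma_of_metric (ι := Set.Icc (0:ℝ) 1) isCompact_Icc
    (c := fun i => ball (i : ℝ) (ε i)) (fun _ => isOpen_ball)
    (fun x hx => Set.mem_iUnion.mpr ⟨⟨x, hx⟩, mem_ball_self (hε x hx)⟩)
  -- a mesh `1/N < δ`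
  obtain ⟨N, hN⟩ := exists_nat_one_div_lt hδ
  refine ⟨N + 1, Nat.succ_pos N, fun k hk => ?_⟩
  have hNpos : (0:ℝ) < (N + 1 : ℕ) := by exact_mod_cast Nat.succ_pos N
  have hk' : (k : ℝ) ≤ N := by exact_mod_cast Nat.lt_succ_iff.mp hk
  -- the left end `x = k/(N+1)` of the `k`-th slab lies in `[0,1]`
  set x : ℝ := (k : ℝ) / (N + 1 : ℕ) with hx
  have hx0 : 0 ≤ x := div_nonneg (Nat.cast_nonneg k) hNpos.le
  have hx1 : x ≤ 1 := by
    rw [hx, div_le_one hNpos]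
    push_cast
    linarith
  obtain ⟨⟨s₀, hs₀⟩, hball⟩ := hcov x ⟨hx0, hx1⟩
  -- both ends of the slab lie in the window of `s₀`
  have hmesh : (1:ℝ) / (N + 1 : ℕ) < δ := by
    simpa using hN
  have hxs : x ∈ ball s₀ (ε s₀) := hball (mem_ball_self hδ)
  have hys : x + 1 / (N + 1 : ℕ) ∈ ball s₀ (ε s₀) := by
    refine hball ?_
    rw [mem_ball, Real.dist_eq, add_sub_cancel_left, abs_of_pos (by positivity)]
    exact hmesh
  rw [mem_ball, Real.dist_eq, abs_lt] at hxs hys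
  refine hslab s₀ hs₀ _ _ ?_ ?_ ?_
  · have : (((k : ℚ) / (N + 1 : ℕ) : ℚ) : ℝ) = x := by rw [hx]; push_cast; ring
    rw [this]; linarith [hxs.1]
  · push_cast
    exact div_lt_div_of_pos_right (by linarith) (by exact_mod_cast Nat.succ_pos N)
  · have : ((((k : ℚ) + 1) / (N + 1 : ℕ) : ℚ) : ℝ) = x + 1 / (N + 1 : ℕ) := by
      rw [hx]; push_cast; ring
    rw [this]; linarith [hys.2]

/-- **`CubeKernelStep` from the composition stubs** (K2, K1-germ; slab gluing LANDED). Verbatim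
the crux-strategist's split glue `MeanRealisation → FibreNullGerm → CubeKernelStep`. -/
theorem cubeKernelStep_of_layers
    (h2 : ∀ d : ℕ, 1 ≤ d →
      (∀ (M : ℕ), M ≤ d → ∀ (a : IntegralRep M),
        a.domain = Set.pi Set.univ (fun _ : Fin M => Set.Icc (0:ℝ) 1) →
        ContinuousOn a.integrand a.domain → a.value = 0 → of a ∈ relations) →
      ∀ (t : IntegralRep (d + 1)),
        t.domain = Set.pi Set.univ (fun _ : Fin (d + 1) => Set.Icc (0:ℝ) 1) →
        ContinuousOn t.integrand t.domain → t.value = 0 →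
        ∃ t' : IntegralRep (d + 1),
          t'.domain = Set.pi Set.univ (fun _ : Fin (d + 1) => Set.Icc (0:ℝ) 1) ∧
          ContinuousOn t'.integrand t'.domain ∧
          (∀ s ∈ Set.Icc (0:ℝ) 1, sliceValue t' s = 0) ∧
          of t - of t' ∈ relations)
    (h1 : ∀ d : ℕ, 1 ≤ d →
      (∀ (M : ℕ), M ≤ d → ∀ (a : IntegralRep M),
        a.domain = Set.pi Set.univ (fun _ : Fin M => Set.Icc (0:ℝ) 1) →
        ContinuousOn a.integrand a.domain → a.value = 0 → of a ∈ relations) →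
      ∀ (t : IntegralRep (d + 1)),
        t.domain = Set.pi Set.univ (fun _ : Fin (d + 1) => Set.Icc (0:ℝ) 1) →
        ContinuousOn t.integrand t.domain →
        (∀ s ∈ Set.Icc (0:ℝ) 1, sliceValue t s = 0) →
        ∀ s₀ ∈ Set.Icc (0:ℝ) 1, ∃ ε : ℝ, 0 < ε ∧
          ∀ a b : ℚ, s₀ - ε ≤ (a : ℝ) → (a : ℝ) < b → (b : ℝ) ≤ s₀ + ε →
            of (t.slabRestrict a b) ∈ relations) :
    ∀ d : ℕ, 1 ≤ d →
      (∀ (M : ℕ), M ≤ d → ∀ (t : IntegralRep M),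
        t.domain = Set.pi Set.univ (fun _ : Fin M => Set.Icc (0:ℝ) 1) →
        ContinuousOn t.integrand t.domain → t.value = 0 → of t ∈ relations) →
      ∀ (t : IntegralRep (d + 1)),
        t.domain = Set.pi Set.univ (fun _ : Fin (d + 1) => Set.Icc (0:ℝ) 1) →
        ContinuousOn t.integrand t.domain → t.value = 0 → of t ∈ relations := by
  intro d hd hLE t htd htc hval
  -- K2: trade `t` for a fibre-null continuous family `t'`
  obtain ⟨t', ht'd, ht'c, ht'n, htt'⟩ := h2 d hd hLE t htd htc hval
  -- K1 at every parameter, a Lebesgue number, slab gluing (landed)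
  obtain ⟨N, hN, hk⟩ := exists_equipartition_of_germs t' (h1 d hd hLE t' ht'd ht'c ht'n)
  have ht' : of t' ∈ relations := stub_slabGluing d t' ht'd N hN hk
  have e : of t = (of t - of t') + of t' := by abel
  rw [e]
  exact relations.add_mem htt' ht'

/-- The registered composition: the crux's ROUTE DECL by name from the composition stubs. -/
theorem CubeKernelStep_of_stubs : CubeKernelStep := by
  intro d hd hLE t htd htc hval
  exact cubeKernelStep_of_layers stub_meanRealisation stub_fibreNullGerm d hd hLE t htd htc hval

end Summit.KontsevichZagierPeriods.KontsevichZagierPeriods.Cruxes.CubeKernelStep.Layers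

end
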